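import Mathlib

/-!
# Order-3 surgery for `MomentParity.QuarticGate` (stmt-AnomalousDissipation-11464), helper III:
# the third-moment shift is a linear-algebra range statement ("QuadRange"), and the chain rule
# transporting polynomial tests to a band basis

Support file for the stub `stub_order3Surgery` of the line `recession-cone` (skeleton
`Cruxes/QuarticGate/Lines/recession-cone.lean`, S5). Two torus-free algebraic facts:

* `exists_eq_sum_mul_of_forall_sum_eq_zero` — if a vector `a ∈ ℝ^A` is killed by every `p ∈ ℝ^A`
  that kills all columns of a matrix `c : A × B → ℝ` (i.e. `a ⊥ ker cᵀ`), then `a` is in the range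
  of `c`: `a α = Σ_β c α β · s β`. In the surgery, `A` indexes the quadratic tests, `B` the cubic
  monomials, `c α` is the cubic form `{p_α, B_N}` of the test `α` (its Euler derivative), `a α` its
  row against the fattened order-2 law, and `-s` is the shift of the third moments that kills every
  quadratic row.
* `pderiv_bind₁` — the chain rule `∂ᵢ(P ∘ φ) = Σⱼ (∂ⱼP ∘ φ) · ∂ᵢφⱼ` for `MvPolynomial.bind₁`, used to
  transport a test `(g, P)` to the band basis `b` (`gⱼ = Σᵢ ⟨gⱼ, bᵢ⟩ bᵢ`), so that all rows are rows
  of tests over one fixed family of test fields.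
-/

-- `Summit.<Summit>.<Problem>` is the tree's mandated summit-side namespace (CONVENTIONS §2); for this
-- single-conjunct summit the two coincide, so the duplicate is deliberate.
set_option linter.dupNamespace false

namespace Summit.AnomalousDissipation.AnomalousDissipation.Theorems.MomentParityQuarticGate

open scoped BigOperators

/-- **QuadRange.** Let `c : A → B → ℝ` (finitely many rows and columns) and `a : A → ℝ`. If every
coefficient vector `p` with `Σ_α p α · c α β = 0` for all `β` also has `Σ_α p α · a α = 0` (the
functional `a` vanishes on the kernel of `p ↦ pᵀc`), then `a` factors through `c`: there is
`s : B → ℝ` with `a α = Σ_β c α β · s β` for every `α`. (Finite-dimensional duality: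
`range (Φᵀ) = (ker Φ)⁰`, `LinearMap.range_dualMap_eq_dualAnnihilator_ker`.) [folklore] -/
theorem exists_eq_sum_mul_of_forall_sum_eq_zero :
    ∀ {A B : Type} [Fintype A] [Fintype B] (c : A → B → ℝ) (a : A → ℝ), (∀ p : A → ℝ, (∀ β, ∑ α, p α
      * c α β = 0) → ∑ α, p α * a α = 0) → ∃ s : B → ℝ, ∀ α, a α = ∑ β, c α β * s β := by
  intro A B _ _ c a h
  classical
  -- `Φ p = pᵀ c`, `ψ p = p ⬝ a`
  let Φ : (A → ℝ) →ₗ[ℝ] (B → ℝ) :=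
    { toFun := fun p β => ∑ α, p α * c α β
      map_add' := fun p q => by
        funext β
        simp only [Pi.add_apply, add_mul, Finset.sum_add_distrib]
      map_smul' := fun r p => by
        funext β
        simp only [Pi.smul_apply, smul_eq_mul, RingHom.id_apply, Finset.mul_sum, mul_assoc] }
  let ψ : (A → ℝ) →ₗ[ℝ] ℝ :=
    { toFun := fun p => ∑ α, p α * a α
      map_add' := fun p q => by
        simp only [Pi.add_apply, add_mul, Finset.sum_add_distrib]
      map_smul' := fun r p => by
        simp only [Pi.smul_apply, smul_eq_mul, RingHom.id_apply, Finset.mul_sum, mul_assoc] }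
  have hψ : ψ ∈ (LinearMap.ker Φ).dualAnnihilator := by
    rw [Submodule.mem_dualAnnihilator]
    intro p hp
    rw [LinearMap.mem_ker] at hp
    exact h p fun β => congr_fun hp β
  rw [← LinearMap.range_dualMap_eq_dualAnnihilator_ker] at hψ
  obtain ⟨τ, hτ⟩ := hψ
  refine ⟨fun β => τ (fun β' => if β = β' then 1 else 0), fun α => ?_⟩
  have hα : a α = ψ (fun α' => if α' = α then 1 else 0) := by
    simp [ψ]
  have hΦα : Φ (fun α' => if α' = α then 1 else 0) = fun β => c α β := by
    funext β
    simp [Φ]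
  rw [hα, ← hτ, LinearMap.dualMap_apply, hΦα, LinearMap.pi_apply_eq_sum_univ τ]
  simp only [smul_eq_mul]

/-- **Chain rule for `bind₁`.** For a substitution `φ : σ → MvPolynomial τ R` (finitely many
variables `σ`) and a polynomial `P` in the variables `σ`,
`∂ᵢ (bind₁ φ P) = Σⱼ bind₁ φ (∂ⱼ P) · ∂ᵢ (φ j)`. [folklore] -/
theorem pderiv_bind₁ {σ τ R : Type*} [CommSemiring R] [Fintype σ] (φ : σ → MvPolynomial τ R)
    (i : τ) (P : MvPolynomial σ R) :
    MvPolynomial.pderiv i (MvPolynomial.bind₁ φ P) =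
      ∑ j, MvPolynomial.bind₁ φ (MvPolynomial.pderiv j P) * MvPolynomial.pderiv i (φ j) := by
  classical
  induction P using MvPolynomial.induction_on with
  | C a => simp
  | add p q hp hq => simp [hp, hq, Finset.sum_add_distrib, add_mul]
  | mul_X p j h =>
    simp only [map_mul, MvPolynomial.bind₁_X_right, Derivation.leibniz, MvPolynomial.pderiv_X,
      smul_eq_mul, map_add, h, Pi.single_apply]
    simp_rw [add_mul, Finset.sum_add_distrib, Finset.mul_sum]
    congr 1
    · rw [Finset.sum_eq_single j]
      · simp
      · intro j' _ hj'
        simp [Ne.symm hj']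
      · intro hj
        exact absurd (Finset.mem_univ j) hj
    · refine Finset.sum_congr rfl fun j' _ => ?_
      ring
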